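import Summits.ABC.ABC.Theorems.LogCardinalitySubPowerStewartYuMain
import HarnessLib

/-!
# Sub-power Stewart–Yu (crux `SubPowerStewartYu`, stmt-ABC-11053), VIII: the slack-or-inflate dichotomy

`Summits/ABC/ABC/Theorems/LogCardinalitySubPowerStewartYuDichotomy.lean` — helper file toward
`Summit.ABC.ABC.Theses.LogCardinality.SubPowerStewartYu`.

`cube_bound`: for an abc triple with `ab > 1` and `L = log R` large (explicit largeness
hypotheses in `K, A, D`), `(log c)³ ≤ 64 K⁹ C³ Λ⁶ Y³ R · e³ · e^{−3c₁L/log L}` with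
`c₁ = 1/(144 C₂)`, `C₂ = 64 Ā² e⁴`. Proof: with junk factors `J_w = ∏_{T_w} 4K²(log q)²` and tail
radicals `r_w = ∏_{T_w} q`, either `J_a J_b J_c e^{3c₁L/log L} ≤ C³ r_a r_b r_c` — the SLACK case,
`cube_slack_case` (this is where near-primorial members live) — or every member is top-heavy
(`r_w < D² e^{6c₁L/log L}`, by `lt_of_prod_mul_gt` and `prod_lt_of_slack_lt`), so that all members
have few primes and the largest top prime `P* ≥ R^{1/4}` carries Stewart's inflation
(`case2_bound_a` for `P* ∣ a` or, by symmetry, `P* ∣ b`; `case2_bound_c` for `P* ∣ c`).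
[cite: StewartYu2001, Theorem 1 (proof scheme)] [cite: Stewart2013, Lemma 8 (arXiv pp. 9–10)].
No new definitions.
-/

noncomputable section

-- `Summit.ABC.ABC.…` is the tree's namespace convention for this sub-problem (summit = problem).
set_option linter.dupNamespace false

open Finset Real Height
open Literature.NumberTheory.DiophantineGeometry
open Literature.NumberTheory.DiophantineGeometry.Dioph
open Literature.NumberTheory.DiophantineGeometry.Pasten
open Literature.Barriers.ABC

namespace Summit.ABC.ABC.Theorems.SubPowerSY

section Dichotomy

variable {K A : ℝ} {a b c : ℕ}

/-- Few primes in a top-heavy member: if `∏_{T} q < D² E` (`T` the tail of `S`, primes) then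
`|S| ≤ 1 + (2 log D + log E) · (3/2)`. [folklore] -/
theorem card_le_of_tail_lt {D E : ℝ} (hD : 1 ≤ D) (hE : 0 < E) (S : Finset ℕ)
    (hS : ∀ q ∈ S, q.Prime)
    (hlt : ∏ q ∈ S.erase (max 1 (S.sup id)), (q : ℝ) < D ^ 2 * E) :
    (S.card : ℝ) ≤ 1 + 3 * Real.log D + 3 / 2 * Real.log E := by
  set T := S.erase (max 1 (S.sup id)) with hT
  have hTprime : ∀ q ∈ T, q.Prime := fun q hq => hS q (Finset.mem_of_mem_erase hq)
  have hT2 : ∀ q ∈ T, 2 ≤ q := fun q hq => (hTprime q hq).two_le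
  have hr0 : 0 < ∏ q ∈ T, (q : ℝ) := Finset.prod_pos fun q hq => by exact_mod_cast (hTprime q hq).pos
  have hD0 : 0 < D := by linarith
  have hcardT := card_mul_log_two_le_log_prod T hT2
  have hlog : Real.log (∏ q ∈ T, (q : ℝ)) < 2 * Real.log D + Real.log E := by
    have := Real.log_lt_log hr0 hlt
    rwa [Real.log_mul (by positivity) hE.ne', Real.log_pow] at this
  have hlog2 : (0.6931471803 : ℝ) < Real.log 2 := Real.log_two_gt_d9
  have hcardS : (S.card : ℝ) ≤ T.card + 1 := by
    exact_mod_cast card_le_card_erase_add_one S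
  have hlogD0 : 0 ≤ Real.log D := Real.log_nonneg hD
  -- `|T| log 2 < 2 log D + log E`, so `|T| ≤ (3/2)(2 log D + log E)` when the latter is `≥ 0`
  have hT : (T.card : ℝ) * Real.log 2 < 2 * Real.log D + Real.log E := lt_of_le_of_lt hcardT hlog
  have hT0 : (0 : ℝ) ≤ T.card := Nat.cast_nonneg _
  nlinarith

/-- **The slack-or-inflate dichotomy: the cube bound in all cases.**
[cite: StewartYu2001, Theorem 1 (proof scheme)] [cite: Stewart2013, Lemma 8 (arXiv pp. 9–10)] -/
theorem cube_bound (hK : 1 ≤ K) (hP : PastenApproximationBound K)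
    (hYu : ∀ (n p : ℕ) (α : Fin n → ℚ) (b : Fin n → ℤ), 1 ≤ n → p.Prime → 5 ≤ p →
      (∀ i, α i ≠ 0 ∧ padicValRat p (α i) = 0) → (∀ e : Fin n → ℤ, ∏ i, α i ^ e i = 1 → e = 0) →
      b ≠ 0 → (padicValRat p (∏ i, α i ^ b i - 1) : ℝ) ≤
        A ^ n * max ((p : ℝ) * ((n : ℝ) / Real.log p) ^ n) (Real.exp n * Real.log p) *
          (∏ i, max 1 (logHeight₁ (α i))) * max (Real.log (2 + ∑ i, |(b i : ℝ)|)) ((n : ℝ) ^ 2))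
    {C : ℝ} (hC1 : 1 ≤ C)
    (hC : ∀ S : Finset ℕ, (∀ p ∈ S, p.Prime) → ∏ p ∈ S, 4 * K ^ 2 * Real.log p ^ 2 / p ≤ C)
    {C₂ : ℝ} (hC₂ : C₂ = 64 * max |A| 1 ^ 2 * Real.exp 4) {D : ℝ} (hD : 1 ≤ D)
    (hDJ : ∀ T : Finset ℕ, (∀ p ∈ T, p.Prime) →
      ∏ p ∈ T, 4 * K ^ 2 * Real.log p ^ 2 ≤ D * Real.sqrt (∏ p ∈ T, (p : ℝ)))
    (h : IsABCTriple a b c) (h1 : 1 < a * b)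
    (hL16 : 16 ≤ Real.log (rad a b c : ℕ))
    (hc2 : ∀ x : ℝ, Real.log (rad a b c : ℕ) / 4 ≤ x → 8 * C₂ * Real.log x ^ 2 ≤ x)
    (hc3 : ∀ x : ℝ, Real.log (rad a b c : ℕ) / 4 ≤ x → 6 + Real.log x ≤ 0.001 * x)
    (hc4 : 2 + 6 * Real.log D ≤ Real.log (rad a b c : ℕ) / (8 * C₂ * Real.log (Real.log (rad a b c : ℕ))))
    (hc5 : 48 * Real.log D ≤ Real.log (rad a b c : ℕ)) :
    Real.log c ^ 3 ≤ 64 * K ^ 9 * C ^ 3 * max 1 (Real.log (rad a b c : ℕ)) ^ 6 *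
      Real.log (max (Real.exp 1) (2 * Real.log c)) ^ 3 * (rad a b c : ℝ) *
      (Real.exp 3 * Real.exp (-(3 * (1 / (144 * C₂)) * Real.log (rad a b c : ℕ) /
        Real.log (Real.log (rad a b c : ℕ))))) := by
  classical
  obtain ⟨ha, hb, habc, hcop⟩ := id h
  have hc : 0 < c := by omega
  have hbc : b.Coprime c := coprime_right_of_isABCTriple h
  have hac : a.Coprime c := coprime_left_of_isABCTriple h
  -- notation (opaque abbreviations)
  obtain ⟨L, hL⟩ : ∃ L : ℝ, L = Real.log (rad a b c : ℕ) := ⟨_, rfl⟩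
  obtain ⟨ℓ, hℓ⟩ : ∃ ℓ : ℝ, ℓ = Real.log L := ⟨_, rfl⟩
  rw [← hL] at hL16 hc2 hc3 hc4 hc5 ⊢
  rw [← hℓ] at hc4 ⊢
  -- constants
  have hAb1 : 1 ≤ max |A| 1 := le_max_right _ _
  have he4 : (54 : ℝ) ≤ Real.exp 4 := by
    have he1 : (2.7182818283 : ℝ) < Real.exp 1 := Real.exp_one_gt_d9
    have h4 : Real.exp 4 = Real.exp 1 ^ 4 := by rw [← Real.exp_nat_mul]; norm_num
    rw [h4]; nlinarith [pow_le_pow_left₀ (by norm_num : (0:ℝ) ≤ 2.7182818283) he1.le 4]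
  have hC₂ge : 3456 ≤ C₂ := by
    rw [hC₂]
    calc (3456 : ℝ) = 64 * 1 * 54 := by norm_num
      _ ≤ 64 * max |A| 1 ^ 2 * Real.exp 4 :=
          mul_le_mul (mul_le_mul_of_nonneg_left (one_le_pow₀ hAb1) (by norm_num)) he4
            (by norm_num) (by positivity)
  have hC₂pos : 0 < C₂ := by linarith
  have hLpos : 0 < L := by linarith
  have hlog16 : (2.76 : ℝ) ≤ Real.log 16 := by
    rw [show (16 : ℝ) = 2 ^ 4 by norm_num, Real.log_pow]; have := Real.log_two_gt_d9
    push_cast; linarith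
  have hℓ276 : 2.76 ≤ ℓ := by rw [hℓ]; exact hlog16.trans (Real.log_le_log (by norm_num) hL16)
  have hℓpos : 0 < ℓ := by linarith
  have hlogD0 : 0 ≤ Real.log D := Real.log_nonneg hD
  -- the saving exponent `ε = 3 c₁ L / ℓ`
  obtain ⟨ε, hε⟩ : ∃ ε : ℝ, ε = 3 * (1 / (144 * C₂)) * L / ℓ := ⟨_, rfl⟩
  have hε0 : 0 ≤ ε := by rw [hε]; positivity
  have hεsmall : ε ≤ L / 48 := by
    rw [hε, div_le_iff₀ hℓpos]
    have h1 : 3 * (1 / (144 * C₂)) * L = L / (48 * C₂) := by field_simp; ring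
    rw [h1]
    have h2 : L / (48 * C₂) ≤ L / 48 := div_le_div_of_nonneg_left hLpos.le (by norm_num) (by nlinarith)
    have h3 : L / 48 ≤ L / 48 * ℓ := le_mul_of_one_le_right (by positivity) (by linarith)
    linarith
  have hE : 0 < Real.exp ε := Real.exp_pos ε
  have htarget : Real.exp (-(3 * (1 / (144 * C₂)) * L / ℓ)) = (Real.exp ε)⁻¹ := by
    rw [← Real.exp_neg, hε]
  -- the junk factors and tail radicals
  have hprime : ∀ n : ℕ, ∀ q ∈ n.primeFactors, q.Prime := fun n q hq => Nat.prime_of_mem_primeFactors hq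
  have hTprime : ∀ n : ℕ, ∀ q ∈ n.primeFactors.erase (max 1 (n.primeFactors.sup id)), q.Prime :=
    fun n q hq => hprime n q (Finset.mem_of_mem_erase hq)
  have hr0 : ∀ n : ℕ, 0 < ∏ q ∈ n.primeFactors.erase (max 1 (n.primeFactors.sup id)), (q : ℝ) :=
    fun n => Finset.prod_pos fun q hq => by exact_mod_cast (hTprime n q hq).pos
  have hJ0 : ∀ n : ℕ, 0 ≤ ∏ q ∈ n.primeFactors.erase (max 1 (n.primeFactors.sup id)),
      (4 * K ^ 2 * Real.log q ^ 2) := fun n => Finset.prod_nonneg fun q _ => by positivity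
  have hJC : ∀ n : ℕ, ∏ q ∈ n.primeFactors.erase (max 1 (n.primeFactors.sup id)),
      (4 * K ^ 2 * Real.log q ^ 2) ≤
      C * ∏ q ∈ n.primeFactors.erase (max 1 (n.primeFactors.sup id)), (q : ℝ) :=
    fun n => prod_mul_log_sq_le_mul_prod hC _ (hTprime n)
  set Ja := ∏ q ∈ a.primeFactors.erase (max 1 (a.primeFactors.sup id)), (4 * K ^ 2 * Real.log q ^ 2)
  set Jb := ∏ q ∈ b.primeFactors.erase (max 1 (b.primeFactors.sup id)), (4 * K ^ 2 * Real.log q ^ 2)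
  set Jc := ∏ q ∈ c.primeFactors.erase (max 1 (c.primeFactors.sup id)), (4 * K ^ 2 * Real.log q ^ 2)
  set ra := ∏ q ∈ a.primeFactors.erase (max 1 (a.primeFactors.sup id)), (q : ℝ)
  set rb := ∏ q ∈ b.primeFactors.erase (max 1 (b.primeFactors.sup id)), (q : ℝ)
  set rc := ∏ q ∈ c.primeFactors.erase (max 1 (c.primeFactors.sup id)), (q : ℝ)
  have hY1 : 1 ≤ Real.log (max (Real.exp 1) (2 * Real.log c)) := one_le_log_max_exp _
  have hpre : 0 ≤ 64 * K ^ 9 * C ^ 3 * max 1 L ^ 6 *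
      Real.log (max (Real.exp 1) (2 * Real.log c)) ^ 3 * (rad a b c : ℝ) := by
    have : 0 ≤ K := by linarith
    have : 0 ≤ C := by linarith
    positivity
  have he3 : 1 ≤ Real.exp 3 := by have := Real.add_one_le_exp (3 : ℝ); linarith
  by_cases hslack : Ja * Jb * Jc * Real.exp ε ≤ C ^ 3 * (ra * rb * rc)
  · -- THE SLACK CASE
    have key := cube_slack_case hK hP hE h h1 hslack
    rw [← hL] at key
    rw [htarget]
    calc Real.log c ^ 3 ≤ _ := key
      _ = 64 * K ^ 9 * C ^ 3 * max 1 L ^ 6 * Real.log (max (Real.exp 1) (2 * Real.log c)) ^ 3 *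
            (rad a b c : ℝ) * (1 * (Real.exp ε)⁻¹) := by rw [div_eq_mul_inv]; ring
      _ ≤ 64 * K ^ 9 * C ^ 3 * max 1 L ^ 6 * Real.log (max (Real.exp 1) (2 * Real.log c)) ^ 3 *
            (rad a b c : ℝ) * (Real.exp 3 * (Real.exp ε)⁻¹) := by
          apply mul_le_mul_of_nonneg_left _ hpre
          exact mul_le_mul_of_nonneg_right he3 (inv_nonneg.mpr hE.le)
  · -- THE TOP-HEAVY CASE
    push Not at hslack
    have hC0 : 0 < C := by linarith
    -- each member is top-heavy: `r_w < D² (e^ε)²`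
    have hlt_a : ra < D ^ 2 * Real.exp ε ^ 2 := by
      have h' := lt_of_prod_mul_gt hC0 (hr0 b) (hr0 c) (hJ0 a) (hJ0 b) hE.le (hJC b) (hJC c) hslack
      have h'' : ra < Ja * Real.exp ε := lt_of_le_of_lt (le_mul_of_one_le_left (hr0 a).le hC1) h'
      exact prod_lt_of_slack_lt hE _ (hTprime a) (hDJ _ (hTprime a)) h''
    have hlt_b : rb < D ^ 2 * Real.exp ε ^ 2 := by
      have hs : C ^ 3 * (rb * ra * rc) < Jb * Ja * Jc * Real.exp ε := by
        rw [show rb * ra * rc = ra * rb * rc by ring, show Jb * Ja * Jc = Ja * Jb * Jc by ring]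
        exact hslack
      have h' := lt_of_prod_mul_gt hC0 (hr0 a) (hr0 c) (hJ0 b) (hJ0 a) hE.le (hJC a) (hJC c) hs
      have h'' : rb < Jb * Real.exp ε := lt_of_le_of_lt (le_mul_of_one_le_left (hr0 b).le hC1) h'
      exact prod_lt_of_slack_lt hE _ (hTprime b) (hDJ _ (hTprime b)) h''
    have hlt_c : rc < D ^ 2 * Real.exp ε ^ 2 := by
      have hs : C ^ 3 * (rc * ra * rb) < Jc * Ja * Jb * Real.exp ε := by
        rw [show rc * ra * rb = ra * rb * rc by ring, show Jc * Ja * Jb = Ja * Jb * Jc by ring]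
        exact hslack
      have h' := lt_of_prod_mul_gt hC0 (hr0 a) (hr0 b) (hJ0 c) (hJ0 a) hE.le (hJC a) (hJC b) hs
      have h'' : rc < Jc * Real.exp ε := lt_of_le_of_lt (le_mul_of_one_le_left (hr0 c).le hC1) h'
      exact prod_lt_of_slack_lt hE _ (hTprime c) (hDJ _ (hTprime c)) h''
    -- `(e^ε)² = e^{6 c₁ L/ℓ}`
    have hE2 : Real.exp ε ^ 2 = Real.exp (6 * (1 / (144 * C₂)) * L / ℓ) := by
      rw [← Real.exp_nat_mul, hε]; ring_nf
    have hE2pos : 0 < Real.exp ε ^ 2 := by positivity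
    -- few primes in each member
    have hlogE2 : Real.log (Real.exp ε ^ 2) = 2 * ε := by
      rw [Real.log_pow, Real.log_exp]; ring
    have hcard : ∀ n : ℕ, ∏ q ∈ n.primeFactors.erase (max 1 (n.primeFactors.sup id)), (q : ℝ) <
        D ^ 2 * Real.exp ε ^ 2 → (n.primeFactors.card : ℝ) ≤ 1 + 3 * Real.log D + 3 * ε := by
      intro n hn
      have := card_le_of_tail_lt hD hE2pos n.primeFactors (hprime n) hn
      rw [hlogE2] at this; linarith
    have hε' : 3 * ε + 3 * ε ≤ L / (8 * C₂ * ℓ) := by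
      rw [hε]
      have : L / (8 * C₂ * ℓ) = 18 * (1 / (144 * C₂)) * L / ℓ := by field_simp; ring
      rw [this]; apply le_of_eq; ring
    have hn_bc : (((b * c).primeFactors.card : ℕ) : ℝ) ≤ 2 + 6 * Real.log D + L / (8 * C₂ * ℓ) := by
      rw [card_primeFactors_mul_of_coprime hb.ne' hc.ne' hbc]; push_cast
      linarith [hcard b hlt_b, hcard c hlt_c]
    have hn_ac : (((a * c).primeFactors.card : ℕ) : ℝ) ≤ 2 + 6 * Real.log D + L / (8 * C₂ * ℓ) := by
      rw [card_primeFactors_mul_of_coprime ha.ne' hc.ne' hac]; push_cast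
      linarith [hcard a hlt_a, hcard c hlt_c]
    have hn_ab : (((a * b).primeFactors.card : ℕ) : ℝ) ≤ 2 + 6 * Real.log D + L / (8 * C₂ * ℓ) := by
      rw [card_primeFactors_mul_of_coprime ha.ne' hb.ne' hcop]; push_cast
      linarith [hcard a hlt_a, hcard b hlt_b]
    -- the top primes and their product
    have hpos1 : ∀ n : ℕ, ∀ q ∈ n.primeFactors, 1 ≤ q := fun n q hq => (hprime n q hq).one_lt.le
    set Pa : ℕ := max 1 (a.primeFactors.sup id) with hPa
    set Pb : ℕ := max 1 (b.primeFactors.sup id) with hPb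
    set Pc : ℕ := max 1 (c.primeFactors.sup id) with hPc
    have hPa1 : (1 : ℝ) ≤ Pa := by exact_mod_cast le_max_left 1 _
    have hPb1 : (1 : ℝ) ≤ Pb := by exact_mod_cast le_max_left 1 _
    have hPc1 : (1 : ℝ) ≤ Pc := by exact_mod_cast le_max_left 1 _
    have hR : ((rad a b c : ℕ) : ℝ) = ((Pa : ℝ) * ra) * ((Pb : ℝ) * rb) * ((Pc : ℝ) * rc) := by
      rw [rad_eq_prod_three h, prod_eq_top_mul_prod_erase _ (hpos1 a),
        prod_eq_top_mul_prod_erase _ (hpos1 b), prod_eq_top_mul_prod_erase _ (hpos1 c)]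
    -- `log (Pa Pb Pc) ≥ 3L/4`
    set M : ℝ := D ^ 2 * Real.exp ε ^ 2 with hM
    have hM0 : 0 < M := by positivity
    have hlogM : Real.log M = 2 * Real.log D + 2 * ε := by
      rw [hM, Real.log_mul (by positivity) hE2pos.ne', Real.log_pow, hlogE2]; ring
    have hprodP : L - 3 * Real.log M ≤ Real.log ((Pa : ℝ) * Pb * Pc) := by
      have hRle : ((rad a b c : ℕ) : ℝ) ≤ (Pa : ℝ) * Pb * Pc * M ^ 3 := by
        rw [hR]
        have hA' : (Pa : ℝ) * ra ≤ Pa * M := mul_le_mul_of_nonneg_left hlt_a.le (by positivity)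
        have hB' : (Pb : ℝ) * rb ≤ Pb * M := mul_le_mul_of_nonneg_left hlt_b.le (by positivity)
        have hC' : (Pc : ℝ) * rc ≤ Pc * M := mul_le_mul_of_nonneg_left hlt_c.le (by positivity)
        have hra0 : 0 ≤ ra := (hr0 a).le
        have hrb0 : 0 ≤ rb := (hr0 b).le
        have hrc0 : 0 ≤ rc := (hr0 c).le
        have := mul_le_mul (mul_le_mul hA' hB' (by positivity) (by positivity)) hC'
          (by positivity) (by positivity)
        calc (Pa : ℝ) * ra * ((Pb : ℝ) * rb) * ((Pc : ℝ) * rc) ≤ Pa * M * (Pb * M) * (Pc * M) := this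
          _ = (Pa : ℝ) * Pb * Pc * M ^ 3 := by ring
      have hRpos : (0 : ℝ) < (rad a b c : ℕ) := lt_of_lt_of_le one_pos (one_le_rad_real a b c)
      have := Real.log_le_log hRpos hRle
      rw [Real.log_mul (by positivity) (by positivity), Real.log_pow, ← hL] at this
      push_cast at this
      linarith
    have h34 : 3 * (L / 4) ≤ Real.log ((Pa : ℝ) * Pb * Pc) := by
      rw [hlogM] at hprodP
      have : 6 * Real.log D ≤ L / 8 := by linarith
      have : 6 * ε ≤ L / 8 := by linarith
      linarith
    -- the largest top prime
    set Pm : ℕ := max Pa (max Pb Pc) with hPm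
    have hPam : Pa ≤ Pm := le_max_left _ _
    have hPbm : Pb ≤ Pm := le_trans (le_max_left _ _) (le_max_right _ _)
    have hPcm : Pc ≤ Pm := le_trans (le_max_right _ _) (le_max_right _ _)
    have hPm0 : (0 : ℝ) < Pm := by
      have : (1 : ℝ) ≤ Pm := le_trans hPa1 (by exact_mod_cast hPam); linarith
    have hlogPm : L / 4 ≤ Real.log (Pm : ℝ) := by
      have h3 : Real.log ((Pa : ℝ) * Pb * Pc) ≤ 3 * Real.log (Pm : ℝ) := by
        have hle : (Pa : ℝ) * Pb * Pc ≤ (Pm : ℝ) ^ 3 := by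
          have h1' : (Pa : ℝ) ≤ Pm := by exact_mod_cast hPam
          have h2' : (Pb : ℝ) ≤ Pm := by exact_mod_cast hPbm
          have h3' : (Pc : ℝ) ≤ Pm := by exact_mod_cast hPcm
          calc (Pa : ℝ) * Pb * Pc ≤ Pm * Pm * Pm :=
                mul_le_mul (mul_le_mul h1' h2' (by positivity) (by positivity)) h3' (by positivity)
                  (by positivity)
            _ = (Pm : ℝ) ^ 3 := by ring
        have := Real.log_le_log (by positivity) hle
        rwa [Real.log_pow] at this
      linarith
    -- dispatch on which member carries the largest top prime
    have hne_of : ∀ n : ℕ, max 1 (n.primeFactors.sup id) = Pm → n.primeFactors.Nonempty := by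
      intro n hn
      by_contra hemp
      rw [Finset.not_nonempty_iff_eq_empty] at hemp
      rw [hemp, Finset.sup_empty, bot_eq_zero, max_eq_left (by norm_num)] at hn
      have : Real.log (Pm : ℝ) = 0 := by rw [← hn]; simp
      linarith
    have hweak : Real.exp 3 * Real.exp (-(3 * L) / (4 * C₂ * ℓ)) ≤ Real.exp 3 * (Real.exp ε)⁻¹ := by
      apply mul_le_mul_of_nonneg_left _ (by positivity)
      rw [← Real.exp_neg, Real.exp_le_exp, hε]
      rw [show -(3 * L) / (4 * C₂ * ℓ) = -(108 * (1 / (144 * C₂)) * L / ℓ) by field_simp; ring]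
      have : 0 ≤ (1 / (144 * C₂)) * L / ℓ := by positivity
      have h' : 3 * (1 / (144 * C₂)) * L / ℓ = 3 * ((1 / (144 * C₂)) * L / ℓ) := by ring
      have h'' : 108 * (1 / (144 * C₂)) * L / ℓ = 108 * ((1 / (144 * C₂)) * L / ℓ) := by ring
      rw [h', h'']; linarith
    rw [htarget]
    rcases max_choice Pa (max Pb Pc) with hma | hmbc
    · -- top prime in `a`
      have hPaeq : Pa = Pm := by rw [hPm, hma]
      have hlogPa : L / 4 ≤ Real.log (Pa : ℝ) := by rw [hPaeq]; exact hlogPm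
      have key := case2_bound_a hK hP hYu hC1 hC hC₂ hD h h1 (hL ▸ hL16) (by rw [← hL]; exact hc2)
        (by rw [← hL]; exact hc3) (by rw [← hL, ← hℓ]; exact hc4) (hne_of a hPaeq)
        (by rw [← hL]; exact hlogPa) (by rw [← hL, ← hℓ, ← hE2]; exact hlt_a)
        (by rw [← hL, ← hℓ]; exact hn_bc)
      rw [← hL, ← hℓ] at key
      exact key.trans (mul_le_mul_of_nonneg_left hweak hpre)
    · rcases max_choice Pb Pc with hmb | hmc
      · -- top prime in `b`: the swapped triple
        have hPbeq : Pb = Pm := by rw [hPm, hmbc, hmb]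
        have hlogPb : L / 4 ≤ Real.log (Pb : ℝ) := by rw [hPbeq]; exact hlogPm
        have h1' : 1 < b * a := by rwa [mul_comm] at h1
        have hrs : rad b a c = rad a b c := rad_swap a b c
        have key := case2_bound_a hK hP hYu hC1 hC hC₂ hD h.swap h1' (by rw [hrs, ← hL]; exact hL16)
          (by rw [hrs, ← hL]; exact hc2) (by rw [hrs, ← hL]; exact hc3)
          (by rw [hrs, ← hL, ← hℓ]; exact hc4) (hne_of b hPbeq)
          (by rw [hrs, ← hL]; exact hlogPb) (by rw [hrs, ← hL, ← hℓ, ← hE2]; exact hlt_b)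
          (by rw [hrs, ← hL, ← hℓ]; exact hn_ac)
        rw [hrs, ← hL, ← hℓ] at key
        exact key.trans (mul_le_mul_of_nonneg_left hweak hpre)
      · -- top prime in `c`
        have hPceq : Pc = Pm := by rw [hPm, hmbc, hmc]
        have hlogPc : L / 4 ≤ Real.log (Pc : ℝ) := by rw [hPceq]; exact hlogPm
        have key := case2_bound_c hK hP hYu hC1 hC hC₂ hD h h1 (hL ▸ hL16) (by rw [← hL]; exact hc2)
          (by rw [← hL]; exact hc3) (by rw [← hL, ← hℓ]; exact hc4) (hne_of c hPceq)
          (by rw [← hL]; exact hlogPc) (by rw [← hL, ← hℓ, ← hE2]; exact hlt_c)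
          (by rw [← hL, ← hℓ]; exact hn_ab)
        rw [← hL, ← hℓ] at key
        exact key.trans (mul_le_mul_of_nonneg_left hweak hpre)

end Dichotomy

end Summit.ABC.ABC.Theorems.SubPowerSY

end
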